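import Summits.KontsevichZagierPeriods.Zeta5Search.Certificates.RayC1KernelClassTable
import HarnessLib

/-!
# ζ(5) search — certificates: DEEP brick shifts (`θ < 1/4`) of the ray RayC1 as a further table source (TYPER g17)

HONEST FRAMING: systematic search; no irrationality claim unless certified.  `p`-adic bookkeeping of explicit rationals; nothing
about `ζ(5)`; every exponent this feeds is `< 1`.

OUR work (Summit side; typer seat, generation 17; generator `HOME/pub-zeta5-typer-g17/gen/gen_kernelclass.py C1`).  Sequel of
`RayC1KernelClassWin` / `RayC1KernelClassTable`.  The brick branch `brickCond` of typer g16 reads the certified `ν`-cells under the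
shifts `m ≤ 3` of `x = n/p − m` (`θ > 1/4`, `n ≥ 1360`).  The tail `θ < 1/4` of the census T profile (`≈ 1.1` nats/step on this ray,
needed by the T1 budget of the ray) is the same cells under deeper shifts; this file adds the source kind `6`:
* `deepCond e` — entry `(A, B, k, 8·(16·i + m) + 6)`: cell `i` of `c1Cells` under the shift `4 ≤ m ≤ 15`, the window inside the
  image `(b₁/(a₁+m b₁), b₀/(a₀+m b₀))` of the cell, `(m+1)·A ≥ 1`, `k ≤ 2c`;
* `deep_entry_cert` — soundness for `n ≥ 21760 = 85·16²` (so that `p > n/(m+1) ≥ n/16` still has `p² > 85n`), via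
  `cell_brick_shift_c1`; `soundChecker_deep : SoundChecker deepCond 21760` — to be `||`-combined with `entryOK` (`soundChecker_or`).
-/

noncomputable section

open Finset

namespace Summit.KontsevichZagierPeriods.Zeta5Search.RayC1

open Summit.KontsevichZagierPeriods.Zeta5Search.DualSeries
open Summit.KontsevichZagierPeriods.Zeta5Search.DualSeriesDenominators
open Summit.KontsevichZagierPeriods.Zeta5Search.WedgeDictionary
open Summit.KontsevichZagierPeriods.Zeta5Search.RayKernel
open Summit.KontsevichZagierPeriods.Zeta5Search.Denom.DigitCert
open Literature.NumberTheory.Irrationality.Hata1992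

/-- **The deep branch of the checker** for an entry `(A, B, k, 8·(16·i + m) + 6)` (decidable): cell `i` valid, `4 ≤ m ≤ 15`, the window
inside the image of the cell's open `x`-interval under `x = n/p − m`, `(m+1)·A ≥ 1`, `A ≤ B ≤ 38`, the cell's sanity, `k ≤ 2c`. -/
def deepCond (e : WinEntry) : Bool :=
  decide (e.2.2.2 % 8 = 6) && decide (e.2.2.2 / 8 / 16 < c1Cells.length) && decide (4 ≤ e.2.2.2 / 8 % 16) &&
  (let C := c1Cells.getD (e.2.2.2 / 8 / 16) ⟨0, 1, 0, 1, 0, []⟩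
   let m : ℕ := e.2.2.2 / 8 % 16
   decide ((C.b1 : ℚ) ≤ ((C.a1 : ℚ) + (m : ℚ) * C.b1) * e.1) && decide (((C.a0 : ℚ) + (m : ℚ) * C.b0) * e.2.1 ≤ (C.b0 : ℚ)) &&
   decide (0 < C.a1) && decide (0 < C.a0) && decide (C.a0 < (C.b0 : ℤ)) && decide (C.a1 ≤ (C.b1 : ℤ)) && decide (0 < C.b1) &&
   decide ((e.2.2.1 : ℤ) ≤ 2 * C.c) && decide (1 ≤ ((m : ℚ) + 1) * e.1) && decide (e.1 ≤ e.2.1) && decide (e.2.1 ≤ 38) &&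
   decide (C.b0 ≤ 85) && decide (C.b1 ≤ 85))

/-- Unpacking the deep branch. -/
theorem deepCond_sound {e : WinEntry} (h : deepCond e = true) :
    ∃ C : Cell, ∃ m : ℕ, C ∈ c1Cells ∧ m ≤ 15 ∧ (C.b1 : ℚ) ≤ ((C.a1 : ℚ) + (m : ℚ) * C.b1) * e.1 ∧
      ((C.a0 : ℚ) + (m : ℚ) * C.b0) * e.2.1 ≤ (C.b0 : ℚ) ∧ 0 < C.a1 ∧ 0 < C.a0 ∧ C.a0 < (C.b0 : ℤ) ∧ C.a1 ≤ (C.b1 : ℤ) ∧ 0 < C.b1 ∧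
      ((e.2.2.1 : ℤ) ≤ 2 * C.c) ∧ 1 ≤ ((m : ℚ) + 1) * e.1 ∧ e.1 ≤ e.2.1 ∧ e.2.1 ≤ 38 ∧ C.b0 ≤ 85 ∧ C.b1 ≤ 85 := by
  simp only [deepCond, Bool.and_eq_true, decide_eq_true_eq, and_assoc] at h
  obtain ⟨-, hlen, -, h1, h2, h3, h4, h5, h6, h7, h8, h9, h10, h11, h12, h13⟩ := h
  refine ⟨c1Cells.getD (e.2.2.2 / 8 / 16) ⟨0, 1, 0, 1, 0, []⟩, e.2.2.2 / 8 % 16, ?_, by omega, h1, h2, h3, h4, h5, h6, h7, h8, h9, h10,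
    h11, h12, h13⟩
  rw [List.getD_eq_getElem _ _ hlen]
  exact List.getElem_mem hlen

/-- **Deep entries**: the certified `ν`-cells under the shifts `4 ≤ m ≤ 15` through `cell_brick_shift_c1` (`n ≥ 21760`). -/
theorem deep_entry_cert {e : WinEntry} (h : deepCond e = true) {n : ℕ} (hn : 21760 ≤ n) {p : ℕ}
    (hp : p ∈ windowPrimes ((e.1 : ℚ) : ℝ) ((e.2.1 : ℚ) : ℝ) n) :
    (p : ℤ) ^ e.2.2.1 ∣ wedgeNumZ (bC1 n) (bC1' n) ∧ (p : ℤ) ^ e.2.2.1 ∣ qNumZ (bC1 n) (bC1' n) := by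
  obtain ⟨C, m, hC, hm, h1, h2, ha1, ha0, ha0b0, ha1b1, hb1pos, hk, hA1, hAB, hBlo, hb0, hb1⟩ := deepCond_sound h
  clear h
  have hm1 : (0 : ℚ) < (m : ℚ) + 1 := by positivity
  have hApos : (0 : ℚ) < e.1 := by nlinarith
  have hA0 : (0 : ℝ) ≤ ((e.1 : ℚ) : ℝ) := by exact_mod_cast hApos.le
  obtain ⟨hpr, hlow, hhigh⟩ := (mem_windowPrimes_iff hA0).1 hp
  have hlow' : e.1 * (n : ℚ) < p := by exact_mod_cast hlow
  have hhigh' : (p : ℚ) ≤ e.2.1 * n := by exact_mod_cast hhigh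
  have hn1 : 1 ≤ n := by omega
  have hnq : (21760 : ℚ) ≤ n := by exact_mod_cast hn
  have hn0 : (0 : ℚ) ≤ n := by positivity
  have hmq : (m : ℚ) ≤ 15 := by exact_mod_cast hm
  have hpgt : (n : ℚ) < ((m : ℚ) + 1) * p := by nlinarith
  have hpc : (85 : ℚ) + 1 < p := by nlinarith
  have hpcN : 85 < p := by exact_mod_cast (show (85 : ℚ) < p by linarith)
  have hpB : p ≤ 85 * n := by exact_mod_cast (show (p : ℚ) ≤ 85 * n by nlinarith)
  have hsq : 85 * n < p ^ 2 := by
    have h3 : (85 : ℚ) * n * 256 ≤ (n : ℚ) * n := by nlinarith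
    have h4 : (n : ℚ) * n < (((m : ℚ) + 1) * p) * (((m : ℚ) + 1) * p) := mul_self_lt_mul_self hn0 hpgt
    have hm4 : (m : ℚ) + 1 ≤ 16 := by linarith
    have hp0' : (0 : ℚ) ≤ p := by positivity
    have h5a : ((m : ℚ) + 1) * p ≤ 16 * p := mul_le_mul_of_nonneg_right hm4 hp0'
    have h5 : (((m : ℚ) + 1) * p) * (((m : ℚ) + 1) * p) ≤ (16 * p) * (16 * (p : ℚ)) :=
      mul_le_mul h5a h5a (by positivity) (by positivity)
    have : (85 : ℚ) * n < (p : ℚ) ^ 2 := by nlinarith [h3, h4, h5]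
    exact_mod_cast this
  have hx1q : (C.b1 : ℚ) * n < ((C.a1 : ℚ) + (m : ℚ) * C.b1) * p := by
    have hpos : (0 : ℚ) < (C.a1 : ℚ) + (m : ℚ) * C.b1 := by
      have : (0 : ℚ) < C.a1 := by exact_mod_cast ha1
      have : (0 : ℚ) ≤ (m : ℚ) * C.b1 := by positivity
      linarith
    nlinarith
  have hx0le : ((C.a0 : ℚ) + (m : ℚ) * C.b0) * p ≤ (C.b0 : ℚ) * n := by
    have hpos : (0 : ℚ) < (C.a0 : ℚ) + (m : ℚ) * C.b0 := by
      have : (0 : ℚ) < C.a0 := by exact_mod_cast ha0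
      have : (0 : ℚ) ≤ (m : ℚ) * C.b0 := by positivity
      linarith
    nlinarith
  have hx1z : (C.b1 : ℤ) * n < (C.a1 + (m : ℤ) * C.b1) * p := by exact_mod_cast hx1q
  have hx0z' : (C.a0 + (m : ℤ) * C.b0) * p ≤ (C.b0 : ℤ) * n := by exact_mod_cast hx0le
  have hb0z : (0 : ℤ) < C.b0 := by have := ha0b0; linarith
  have hb1z : (0 : ℤ) < C.b1 := by exact_mod_cast hb1pos
  have hpb0 : (C.b0 : ℕ) < p := by omega
  have hx0z : (C.a0 + (m : ℤ) * C.b0) * p < (C.b0 : ℤ) * n := by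
    rcases hx0z'.lt_or_eq with hlt | heq
    · exact hlt
    · exfalso
      have hdvd : (p : ℤ) ∣ (C.b0 : ℤ) * n := ⟨C.a0 + (m : ℤ) * C.b0, by linarith⟩
      have hdvd' : p ∣ C.b0 * n := by exact_mod_cast hdvd
      rcases (Nat.Prime.dvd_mul hpr).1 hdvd' with h | h
      · exact absurd (Nat.le_of_dvd (by exact_mod_cast hb0z) h) (by omega)
      · obtain ⟨q, hq⟩ := h
        have hq' : (n : ℤ) = p * q := by exact_mod_cast hq
        rw [hq'] at heq
        have hp0 : (0 : ℤ) < p := by exact_mod_cast hpr.pos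
        have e1 : C.a0 = C.b0 * ((q : ℤ) - m) := by
          have : (p : ℤ) * (C.a0 + (m : ℤ) * C.b0 - C.b0 * q) = 0 := by linarith
          rcases mul_eq_zero.1 this with h0 | h0
          · linarith
          · linarith
        have t1 : 0 < (q : ℤ) - m := by
          by_contra hcon
          have : C.b0 * ((q : ℤ) - m) ≤ 0 := mul_nonpos_of_nonneg_of_nonpos hb0z.le (not_lt.1 hcon)
          linarith
        have t2 : (q : ℤ) - m < 1 := by
          by_contra hcon
          have : C.b0 * 1 ≤ C.b0 * ((q : ℤ) - m) := mul_le_mul_of_nonneg_left (not_lt.1 hcon) hb0z.le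
          linarith
        omega
  have hnd : ¬ p ∣ n := by
    rintro ⟨q, hq⟩
    have hq' : (n : ℤ) = p * q := by exact_mod_cast hq
    rw [hq'] at hx0z hx1z
    have hp0 : (0 : ℤ) < p := by exact_mod_cast hpr.pos
    have k0 : C.a0 + (m : ℤ) * C.b0 < C.b0 * q := lt_of_mul_lt_mul_right (by linarith [hx0z]) hp0.le
    have k1 : C.b1 * (q : ℤ) < C.a1 + (m : ℤ) * C.b1 := lt_of_mul_lt_mul_right (by linarith [hx1z]) hp0.le
    have t2 : (q : ℤ) - m < 1 := by
      by_contra hcon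
      have : C.b1 * 1 ≤ C.b1 * ((q : ℤ) - m) := mul_le_mul_of_nonneg_left (not_lt.1 hcon) hb1z.le
      linarith
    have t1 : 0 < (q : ℤ) - m := by
      by_contra hcon
      have : C.b0 * ((q : ℤ) - m) ≤ 0 := mul_nonpos_of_nonneg_of_nonpos hb0z.le (not_lt.1 hcon)
      linarith
    omega
  have hx0 : C.a0 * (p : ℤ) < (C.b0 : ℤ) * ((n : ℤ) - m * p) := by linarith
  have hx1 : (C.b1 : ℤ) * ((n : ℤ) - m * p) < C.a1 * (p : ℤ) := by linarith
  exact cell_brick_shift_c1 hC hn1 hpr hnd hpB hsq (by omega) m hx0 hx1 hk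

/-- Every deep entry is a genuine window below the big-prime atlas: `0 < A ≤ B ≤ 38`. -/
theorem deep_basic {e : WinEntry} (h : deepCond e = true) : 0 < e.1 ∧ e.1 ≤ e.2.1 ∧ e.2.1 ≤ 38 := by
  obtain ⟨-, m, -, -, -, -, -, -, -, -, -, -, hA1, hAB, hBlo, -⟩ := deepCond_sound h
  clear h
  have hm0 : (0 : ℚ) < (m : ℚ) + 1 := by positivity
  exact ⟨by nlinarith, hAB, hBlo⟩

/-- **`deepCond` is sound from `n ≥ 21760`.** -/
theorem soundChecker_deep : SoundChecker deepCond 21760 :=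
  fun _ h => ⟨deep_basic h, fun _ hn _ hp => deep_entry_cert h hn hp⟩

/-- The round checker with the deep source: `entryOK cw 1360 e || deepCond e`, sound from `n ≥ 21760` under `∀ c ∈ cw, c.Holds`. -/
theorem soundChecker_entryOK_deep {cw : List CWin} (hcw : ∀ c ∈ cw, c.Holds) :
    SoundChecker (fun e => entryOK cw 1360 e || deepCond e) 21760 :=
  soundChecker_or (soundChecker_mono (soundChecker_entryOK hcw le_rfl) (by norm_num)) soundChecker_deep

end Summit.KontsevichZagierPeriods.Zeta5Search.RayC1
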